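import Summits.CriticalPhenomena.PercolationContinuityZ3.Theorems.PercNearOneGluingNoHeavyLowerTailKnQuestion8CoefficientwiseCoreClassDomPocketFree
import HarnessLib

/-!
# THEOREM BUNDLE: CW-PA on the core class `N(x) = N(z) = {a, b}` over every middle graph whose non-terminal vertices have degree `≤ 2`

Support file (`--supports stmt-CriticalPhenomena-4575`, closed), prover `prim-cplus-coupling` (gen 30).  No definitions, no notations, no named facts,
no sorries; standard axioms.  Memo `prim-cplus-coupling/A5-COUPLING-gen30.md` §1.  Companions `…CoreClassDom` (THEOREM KB-DOM), `…CoreClassDomPocketFree`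
(THEOREM R_A-DOM: pocket-free middle graphs carry the explicit domination map `R_A`).

* `Coefficientwise.pocketFree_of_deg_le_two` — if every vertex `u ≠ a, b` of the middle graph `H = (V, E)` lies on at most two edges of `E`, then
  `(H; a, b)` is POCKET-FREE: for every colouring `ω ⊆ E` with `a ∉ C_b(E ∖ ω)`, every vertex of the blue cluster `Q = C_b(E ∖ ω)` outside the red cluster
  `P = C_a(ω)` is joined to `b` by a blue path avoiding `P` (`Q ⊆ P ∪ C_b({blue edges away from P})`).  Proof (closed-set principle): the set
  `Q^out ∪ D₁`, `Q^out` = blue cluster of `b` away from `P`, `D₁` = vertices of `P ∖ {a}` with a blue edge into `Q^out`, contains `b` and is closed under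
  blue edges — a vertex of `D₁` carries a red edge (it is in `P ∖ {a}`) and a blue edge into `Q^out`, hence no third edge.
* `Coefficientwise.cwpa_coreClass_of_deg_le_two` — hence (THEOREM R_A-DOM + KB-DOM) **the coefficientwise first rung CW-PA holds, for all monotone
  `f, g`, on the core class over every such middle graph**: all bundles `Θ(k₁, …, k_r)` of internally disjoint `a–b` threads of any lengths and any
  number `r` (with or without the edge `ab`), i.e. `W₀ = K₄ − xz` with its edge `ab` replaced by an arbitrary bundle — the 'doubly-marked bundle'
  substitutions that prim-lf-2's series–parallel calculus does not reach (`prim-lf-2/CW-REDUCTION-gen26.md` §5) — and every other middle graph of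
  internal maximum degree `2`.
[cite: KozmaNitzan2024, Questions 8–9 (§5.5 p. 36) (context: the Question-8 pocket covariance programme)]
-/

namespace Summit.CriticalPhenomena.PercolationContinuityZ3.Theorems

open Finset Literature.Probability.Percolation
open scoped symmDiff

namespace Coefficientwise

variable {ι V : Type*}

open Classical in
/-- **Internal degree `≤ 2` forces pocket-freeness.**  Let `E` be an edge set of the multigraph `ends`, `a, b` vertices such that no vertex
`u ≠ a, b` lies on three distinct edges of `E`.  Then for every `ω ⊆ E` with `a ∉ C_b(E ∖ ω)`:
`C_b(E ∖ ω) ⊆ C_a(ω) ∪ C_b({i ∈ E ∖ ω : no end of i lies in C_a(ω)})`. [cite: KozmaNitzan2024, §5.5 (context only)] -/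
theorem pocketFree_of_deg_le_two (ends : ι → Sym2 V) (E : Finset ι) (a b : V)
    (hdeg : ∀ u, u ≠ a → u ≠ b → ∀ i j k, i ∈ E → j ∈ E → k ∈ E → u ∈ ends i → u ∈ ends j → u ∈ ends k → i = j ∨ i = k ∨ j = k)
    (ω : Finset ι) (hω : ω ⊆ E) (hbR : b ∉ openCluster (ends '' (↑ω : Set ι)) a)
    (haB : a ∉ openCluster (ends '' (↑(E \ ω) : Set ι)) b) :
    openCluster (ends '' (↑(E \ ω) : Set ι)) b ⊆ openCluster (ends '' (↑ω : Set ι)) a ∪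
      openCluster (ends '' (↑((E \ ω).filter (fun i => ∀ v, v ∈ ends i → v ∉ openCluster (ends '' (↑ω : Set ι)) a)) : Set ι)) b := by
  set P : Set V := openCluster (ends '' (↑ω : Set ι)) a with hP
  set Bl : Finset ι := E \ ω with hBl
  set Off : Finset ι := Bl.filter (fun i => ∀ v, v ∈ ends i → v ∉ P) with hOff
  set Qout : Set V := openCluster (ends '' (↑Off : Set ι)) b with hQout
  have hOffBl : Off ⊆ Bl := Finset.filter_subset _ _
  have hQoutQ : Qout ⊆ openCluster (ends '' (↑Bl : Set ι)) b := openCluster_image_mono ends hOffBl b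
  -- vertices of `Qout` lie outside `P`
  have hQoutP : ∀ u, u ∈ Qout → u ∉ P := by
    intro u hu huP
    by_cases hub : u = b
    · rw [hub] at huP; exact hbR huP
    · obtain ⟨i, hi, hui⟩ := exists_edge_of_mem_openCluster ends hu hub
      rw [hOff, Finset.mem_filter] at hi
      exact hi.2 u hui huP
  -- the closed set `Qout ∪ D₁`
  set D₁ : Set V := {u | u ∈ P ∧ u ≠ a ∧ ∃ i ∈ Bl, ∃ q, ends i = s(u, q) ∧ q ∈ Qout} with hD₁
  have key : openCluster (ends '' (↑Bl : Set ι)) b ⊆ Qout ∪ D₁ := by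
    refine openCluster_subset_of_closed ends Bl b (S := Qout ∪ D₁) (Or.inl (mem_openCluster_self _ _)) ?_
    intro i hi u v he hu
    rcases hu with hu | hu
    · -- `u ∈ Qout`
      by_cases hvP : v ∈ P
      · right
        refine ⟨hvP, ?_, i, hi, u, by rw [he, Sym2.eq_swap], hu⟩
        rintro rfl
        exact haB (mem_openCluster_of_edge ends hi he (hQoutQ hu))
      · left
        have hiOff : i ∈ Off := by
          rw [hOff, Finset.mem_filter]
          refine ⟨hi, fun w hw hwP => ?_⟩
          rw [he, Sym2.mem_iff] at hw
          rcases hw with rfl | rfl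
          · exact hQoutP _ hu hwP
          · exact hvP hwP
        exact mem_openCluster_of_edge ends hiOff he hu
    · -- `u ∈ D₁`: a red edge and a blue edge into `Qout` at `u`, so the blue edge `i` is that blue edge
      obtain ⟨huP, hua, i₀, hi₀, q, he₀, hq⟩ := hu
      have hub : u ≠ b := by rintro rfl; exact hbR huP
      obtain ⟨r, hr, hur⟩ := exists_edge_of_mem_openCluster ends huP hua
      have hri₀ : r ≠ i₀ := by rintro rfl; exact (Finset.mem_sdiff.mp hi₀).2 hr
      have hri : r ≠ i := by rintro rfl; exact (Finset.mem_sdiff.mp hi).2 hr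
      have hu_i : u ∈ ends i := by rw [he]; exact Sym2.mem_mk_left u v
      have hu_i₀ : u ∈ ends i₀ := by rw [he₀]; exact Sym2.mem_mk_left u q
      rcases hdeg u hua hub r i₀ i (hω hr) (Finset.mem_sdiff.mp hi₀).1 (Finset.mem_sdiff.mp hi).1 hur hu_i₀ hu_i with h | h | h
      · exact absurd h hri₀
      · exact absurd h hri
      · rw [h] at he₀
        have hqv : s(u, q) = s(u, v) := by rw [← he₀, he]
        rw [Sym2.eq_iff] at hqv
        rcases hqv with ⟨_, hqv⟩ | ⟨huv, hqu⟩
        · left; rw [← hqv]; exact hq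
        · right; rw [← huv]; exact ⟨huP, hua, i, hi, q, by rw [he, ← huv, hqu], hq⟩
  intro y hy
  rcases key hy with h | h
  · exact Or.inr h
  · exact Or.inl h.1

open Classical in
/-- **THEOREM BUNDLE — CW-PA on the core class over a middle graph of internal degree `≤ 2`.**  Core class as in `cwpa_coreClass_of_dom`
(`E₀ = E_H ∪ {ixa, ixb, iza, izb}`, no edge of `E_H` at `x` or `z`); if no vertex `u ≠ a, b` lies on three distinct edges of `E_H` (all bundles
`Θ(k₁, …, k_r)` of `a–b` threads, with or without the edge `ab`; every middle graph of internal maximum degree `2`), then for ALL monotone `f, g`: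
`0 ≤ Σ_{s ⊆ E₀ : z ∉ C_x(s), z ∉ C_x(E₀∖s)} f(C_x s)·(g(C_x s) − g(C_x(E₀∖s)))`.  [cite: KozmaNitzan2024, Questions 8–9 (§5.5 p. 36) (context)] -/
theorem cwpa_coreClass_of_deg_le_two (ends : ι → Sym2 V) (EH E₀ : Finset ι) (x z a b : V) (ixa ixb iza izb : ι)
    (hxa : ends ixa = s(x, a)) (hxb : ends ixb = s(x, b)) (hza : ends iza = s(z, a)) (hzb : ends izb = s(z, b))
    (hH : ∀ i ∈ EH, x ∉ ends i ∧ z ∉ ends i) (hE₀ : ∀ i, i ∈ E₀ ↔ i ∈ EH ∨ i = ixa ∨ i = ixb ∨ i = iza ∨ i = izb)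
    (hnot : ixa ∉ EH ∧ ixb ∉ EH ∧ iza ∉ EH ∧ izb ∉ EH)
    (hd : ixa ≠ ixb ∧ ixa ≠ iza ∧ ixa ≠ izb ∧ ixb ≠ iza ∧ ixb ≠ izb ∧ iza ≠ izb)
    (hxz : x ≠ z) (hxa' : x ≠ a) (hxb' : x ≠ b) (hza' : z ≠ a) (hzb' : z ≠ b)
    (hdeg : ∀ u, u ≠ a → u ≠ b → ∀ i j k, i ∈ EH → j ∈ EH → k ∈ EH → u ∈ ends i → u ∈ ends j → u ∈ ends k → i = j ∨ i = k ∨ j = k)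
    (f g : Set V → ℝ) (hf : Monotone f) (hg : Monotone g) :
    0 ≤ ∑ s ∈ E₀.powerset.filter (fun s : Finset ι => z ∉ openCluster (ends '' (↑s : Set ι)) x ∧ z ∉ openCluster (ends '' (↑(E₀ \ s) : Set ι)) x),
      f (openCluster (ends '' (↑s : Set ι)) x) * (g (openCluster (ends '' (↑s : Set ι)) x) - g (openCluster (ends '' (↑(E₀ \ s) : Set ι)) x)) := by
  refine cwpa_coreClass_of_pocketFree ends EH E₀ x z a b ixa ixb iza izb hxa hxb hza hzb hH hE₀ hnot hd hxz hxa' hxb' hza' hzb' ?_ f g hf hg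
  intro ω hω hbR hbB
  exact pocketFree_of_deg_le_two ends EH a b hdeg ω hω hbR (fun h => hbB ((mem_openCluster_comm ends (EH \ ω) a b).mpr h))

end Coefficientwise

end Summit.CriticalPhenomena.PercolationContinuityZ3.Theorems
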